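import Mathlib
import HarnessLib
import Summits.HubbardSuperconductivity.HubbardSuperconductivity.Theorems.KLProgrammeKLRegimeCountertermJacksonSelfMap
import Summits.HubbardSuperconductivity.HubbardSuperconductivity.Theorems.KLProgrammeKLRegimeCountertermContinuationHA

/-!
# Route `KLProgramme` — child Counterterm of crux K3 at GEN 5 (`CountertermP2 klPredsV13 klWindowC`, Δ23 / (R-I-min)):
# THE WHOLESALE CONTINUATION AT ONE VOLUME WITH THE SMOOTHED PICARD STEP (seat hubbard-kl-k3c3-p2, «fixed point on FrameOK's tube»)

`…CountertermContinuationHA` with the two-leg PIECES as functions (`ℓ_i^{Fn}(K) := klTwoLegPieceFn … K.eval i`; gen-5 slot texts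
`TwoLegSizesFn` / `FrameLipschitzFnT` / `TwoLegSizesMSFn`) and the Picard step SMOOTHED by the Jackson mean of fixed degree `d`:
`Φ_n(K) := −Σ_{i≤n} ℓ_i^{Fn}(K)` (`ctPhiJ`), `K′ := jacksonFrame d Φ_n(K)` (`ctIterJ`), `S_j(K) := K + Σ_{i≤j} ℓ_i^{Fn}(K) = K − Φ_j(K)`.
One step at level `n` from an admissible `K` renormalised below `n` with `sup|S_n(K)| ≤ δ`: `K′` is ADMISSIBLE (`frameOK_jackson_of_multiSlotFn′`),
`frameDist K K′ ≤ δ + η` with the smoothing displacement `η = π⁶/(d+1)·Σ_i twoLegBar 1 i` ((J3), tier-1 `j = 1` sizes),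
`S_j(K′) = (K′ − Φ_n(K)) + Σ_{i≤j}(ℓ_i(K′) − ℓ_i(K)) − Σ_{j<i≤n} ℓ_i(K)` ⇒ `sup|S_j(K′)| ≤ η + q(δ+η) + T̄_{j,n}` ((E3c-T), tails), and `K′` is
RENORMALISED at every `j ≤ n` by the reading hypothesis WITHOUT slack (the reading is an identity for function pieces; discharged in
`…CountertermOneVolumeJ`, where also `d = d(β,U,G,R)` meets the two smallness conditions on `η`).  Inputs as HYPOTHESES: the gen-5 block
`TwoLegSizesFn ∧ FrameLipschitzFnT H ∧ TwoLegSizesMSFn ∧ (RenormalisedAtF n → H K n)` (`H` arbitrary), `hread`, the numeric side conditions of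
`…ContinuationHA` (sharp room).  Main results: `ct_stepJ`, `ct_levelUpJ`, `ct_exists_postJ`, **`ct_oneVolume_of_readingJ`**.  Proofs only.
-/

noncomputable section

namespace Summit.HubbardSuperconductivity.HubbardSuperconductivity.Theorems.KLRegimeSplit

set_option linter.dupNamespace false -- summit = problem name (single-conjunct summit), D-0017

open Real Finset
open Literature.MathematicalPhysics.QuantumLattice Literature.Probability.LatticeModels
open Summit.HubbardSuperconductivity.HubbardSuperconductivity.Theorems.KLProgrammeLegKernels

/-! ## §1 The smoothed wholesale iterate and its displacement -/

section Defs

variable (L M : ℕ) [NeZero L] [NeZero M]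

/-- **`Φ_n(K)(q) := −Σ_{i≤n} ℓ_i^{Fn}(K)(q)`** — the wholesale counterterm symbol at level `n` (a function on the zone). -/
def ctPhiJ (β U μ : ℝ) (K : TrigPolyC4v) (n : ℕ) : FrameFn :=
  fun q => -∑ i ∈ range (n + 1), klTwoLegPieceFn L M β U μ K.eval i q

/-- **The smoothed Picard iterate `K′ := 𝒥_d Φ_n(K)`** as a frame of the unchanged carrier. -/
def ctIterJ (d : ℕ) (β U μ : ℝ) (K : TrigPolyC4v) (n : ℕ) : TrigPolyC4v :=
  jacksonFrame d (ctPhiJ L M β U μ K n)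

end Defs

section Block

variable {L M : ℕ} [NeZero L] [NeZero M] {G : GeoConsts} {Q : EngConsts} {β U μ : ℝ} {R : RenConsts}
  {H : TrigPolyC4v → ℕ → Prop}

/-- `S_n(K)(q) = K(q) − Φ_n(K)(q)`. -/
theorem partialSumJ_eq (β U μ : ℝ) (K : TrigPolyC4v) (n : ℕ) (q : Fin 2 → ℝ) :
    K.eval q + ∑ i ∈ range (n + 1), klTwoLegPieceFn L M β U μ K.eval i q = K.eval q - ctPhiJ L M β U μ K n q := by
  simp [ctPhiJ]

/-- From the gen-5 block: the scale-`i` function piece of a frame renormalised below `i` is bounded by `twoLegBar 0 i` everywhere. -/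
theorem abs_pieceFn_le_of_blockJ
    (blk : ∀ K : TrigPolyC4v, FrameOK R U (nScales β) μ K → ∀ n : ℕ, n ≤ nScales β →
      (∀ j < n, RenormalisedAtF L M β U μ K R j) →
        TwoLegSizesFn L M G Q R β U μ K.eval n ∧ FrameLipschitzFnT L M H G Q R β U μ K n ∧
          TwoLegSizesMSFn L M G Q R β U μ K.eval n ∧ (RenormalisedAtF L M β U μ K R n → H K n))
    {K : TrigPolyC4v} (hK : FrameOK R U (nScales β) μ K) {i : ℕ} (hi : i ≤ nScales β)
    (hren : ∀ j < i, RenormalisedAtF L M β U μ K R j) (p : Fin 2 → ℝ) :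
    |klTwoLegPieceFn L M β U μ K.eval i p| ≤ twoLegBar G Q U 0 i := by
  have h := ((blk K hK i hi hren).1).2.1 0 (by norm_num) (WithLp.toLp 2 p)
  rw [norm_iteratedFDeriv_zero, Real.norm_eq_abs] at h; simpa [onM] using h

/-- From the gen-5 block: the function pieces `i ≤ n` of a frame renormalised below `n` are symmetric `C⁴` frames with tier-1 gradient bound. -/
theorem pieceFn_regular_of_blockJ
    (blk : ∀ K : TrigPolyC4v, FrameOK R U (nScales β) μ K → ∀ n : ℕ, n ≤ nScales β →
      (∀ j < n, RenormalisedAtF L M β U μ K R j) →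
        TwoLegSizesFn L M G Q R β U μ K.eval n ∧ FrameLipschitzFnT L M H G Q R β U μ K n ∧
          TwoLegSizesMSFn L M G Q R β U μ K.eval n ∧ (RenormalisedAtF L M β U μ K R n → H K n))
    {K : TrigPolyC4v} (hK : FrameOK R U (nScales β) μ K) {i : ℕ} (hi : i ≤ nScales β)
    (hren : ∀ j < i, RenormalisedAtF L M β U μ K R j) :
    IsSymmetricFrame (klTwoLegPieceFn L M β U μ K.eval i) ∧ ContDiff ℝ 4 (onM (klTwoLegPieceFn L M β U μ K.eval i)) ∧
      ∀ x, ‖iteratedFDeriv ℝ 1 (onM (klTwoLegPieceFn L M β U μ K.eval i)) x‖ ≤ twoLegBar G Q U 1 i := by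
  obtain ⟨hsz, -, hms, -⟩ := blk K hK i hi hren
  obtain ⟨lp, hdec, hreg, -, -⟩ := hms
  refine ⟨?_, hsz.1, fun x => hsz.2.1 1 (by norm_num) x⟩
  have hfun : klTwoLegPieceFn L M β U μ K.eval i = fun p => lp i p + ∑ m ∈ Ioc i (nScales β), lp m p := funext hdec
  rw [hfun]
  exact (hreg i).1.add' (isSymmetricFrame_finset_sum _ fun m _ => (hreg m).1)

/-- **The symbol `Φ_n(K)` is a symmetric `C⁴` frame with gradient bound `Σ_{i≤n} twoLegBar 1 i`** (pieces `i ≤ n` renormalised below). -/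
theorem ctPhiJ_regular
    (blk : ∀ K : TrigPolyC4v, FrameOK R U (nScales β) μ K → ∀ n : ℕ, n ≤ nScales β →
      (∀ j < n, RenormalisedAtF L M β U μ K R j) →
        TwoLegSizesFn L M G Q R β U μ K.eval n ∧ FrameLipschitzFnT L M H G Q R β U μ K n ∧
          TwoLegSizesMSFn L M G Q R β U μ K.eval n ∧ (RenormalisedAtF L M β U μ K R n → H K n))
    {K : TrigPolyC4v} (hK : FrameOK R U (nScales β) μ K) {n : ℕ} (hn : n ≤ nScales β)
    (hren : ∀ j < n, RenormalisedAtF L M β U μ K R j) :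
    IsSymmetricFrame (ctPhiJ L M β U μ K n) ∧ ContDiff ℝ 4 (onM (ctPhiJ L M β U μ K n)) ∧
      ∀ x, ‖fderiv ℝ (onM (ctPhiJ L M β U μ K n)) x‖ ≤ ∑ i ∈ range (n + 1), twoLegBar G Q U 1 i := by
  have hreg : ∀ i ∈ range (n + 1), IsSymmetricFrame (klTwoLegPieceFn L M β U μ K.eval i) ∧
      ContDiff ℝ 4 (onM (klTwoLegPieceFn L M β U μ K.eval i)) ∧
        ∀ x, ‖iteratedFDeriv ℝ 1 (onM (klTwoLegPieceFn L M β U μ K.eval i)) x‖ ≤ twoLegBar G Q U 1 i := by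
    intro i hi
    have hin : i ≤ n := Nat.lt_succ_iff.mp (mem_range.mp hi)
    exact pieceFn_regular_of_blockJ blk hK (hin.trans hn) fun j hj => hren j (lt_of_lt_of_le hj hin)
  have hsum : onM (ctPhiJ L M β U μ K n) = -(fun x => ∑ i ∈ range (n + 1), onM (klTwoLegPieceFn L M β U μ K.eval i) x) := by
    funext x; simp [onM, ctPhiJ]
  refine ⟨(isSymmetricFrame_finset_sum _ fun i hi => (hreg i hi).1).neg', ?_, fun x => ?_⟩
  · rw [hsum]; exact (ContDiff.sum fun i hi => (hreg i hi).2.1).neg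
  · rw [show ‖fderiv ℝ (onM (ctPhiJ L M β U μ K n)) x‖ = ‖iteratedFDeriv ℝ 1 (onM (ctPhiJ L M β U μ K n)) x‖ from by
      rw [← norm_iteratedFDeriv_fderiv, norm_iteratedFDeriv_zero]]
    rw [hsum, iteratedFDeriv_neg_apply, norm_neg,
      iteratedFDeriv_fun_sum_apply fun i hi => (((hreg i hi).2.1).of_le (by norm_num)).contDiffAt]
    exact (norm_sum_le _ _).trans (sum_le_sum fun i hi => (hreg i hi).2.2 x)

/-- **The smoothing displacement**: `|K′(q) − Φ_n(K)(q)| ≤ η := π⁶/(d+1)·Σ_{i≤n} twoLegBar 1 i` ((J1) + (J3)). -/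
theorem abs_eval_ctIterJ_sub_ctPhiJ_le
    (blk : ∀ K : TrigPolyC4v, FrameOK R U (nScales β) μ K → ∀ n : ℕ, n ≤ nScales β →
      (∀ j < n, RenormalisedAtF L M β U μ K R j) →
        TwoLegSizesFn L M G Q R β U μ K.eval n ∧ FrameLipschitzFnT L M H G Q R β U μ K n ∧
          TwoLegSizesMSFn L M G Q R β U μ K.eval n ∧ (RenormalisedAtF L M β U μ K R n → H K n))
    {K : TrigPolyC4v} (hK : FrameOK R U (nScales β) μ K) {n : ℕ} (hn : n ≤ nScales β)
    (hren : ∀ j < n, RenormalisedAtF L M β U μ K R j) (d : ℕ) (q : Fin 2 → ℝ) :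
    |(ctIterJ L M d β U μ K n).eval q - ctPhiJ L M β U μ K n q| ≤
      π ^ 6 / (d + 1) * ∑ i ∈ range (n + 1), twoLegBar G Q U 1 i := by
  obtain ⟨hsym, hsm, hgrad⟩ := ctPhiJ_regular blk hK hn hren
  have hc : Continuous (ctPhiJ L M β U μ K n) := continuous_of_contDiff_onM hsm
  rw [ctIterJ, eval_jacksonFrame hc hsym.1 hsym.2.1 hsym.2.2]
  exact abs_jsmooth_sub_self_le d hc (hsm.differentiable (by norm_num)) hgrad q

end Block

/-! ## §2 One smoothed Picard step -/

section Step

variable {L M : ℕ} [NeZero L] [NeZero M] {G : GeoConsts} {Q : EngConsts} {β U μ : ℝ} {R : RenConsts}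
  {H : TrigPolyC4v → ℕ → Prop}

/-- **ONE SMOOTHED PICARD STEP at level `n`.**  From an admissible `K` renormalised below `n` with `sup|S_n(K)| ≤ δ`, a displacement bound
`π⁶/(d+1)·Σ_{i≤N} twoLegBar 1 i ≤ η`, and the feasibility `T̄_{j,n} + q·(δ+η) + η ≤ tol_j` (`j ≤ n`): `K′ = 𝒥_d Φ_n(K)` is admissible,
renormalised at every `j ≤ n`, and `sup|S_j(K′)| ≤ T̄_{j,n} + q·(δ+η) + η`. -/
theorem ct_stepJ (hG : G.WF) (hQ : Q.WF) (hμ : μ ∈ klWindowC) (hR : ∀ j, 0 ≤ R.Gfr j) (hcr : R.cr = ctCr G)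
    (blk : ∀ K : TrigPolyC4v, FrameOK R U (nScales β) μ K → ∀ n : ℕ, n ≤ nScales β →
      (∀ j < n, RenormalisedAtF L M β U μ K R j) →
        TwoLegSizesFn L M G Q R β U μ K.eval n ∧ FrameLipschitzFnT L M H G Q R β U μ K n ∧
          TwoLegSizesMSFn L M G Q R β U μ K.eval n ∧ (RenormalisedAtF L M β U μ K R n → H K n))
    (hread : ∀ K : TrigPolyC4v, FrameOK R U (nScales β) μ K → ∀ n : ℕ, n ≤ nScales β → ∀ B : ℝ,
        (∀ q : Fin 2 → ℝ, |K.eval q + ∑ i ∈ range (n + 1), klTwoLegPieceFn L M β U μ K.eval i q| ≤ B) →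
          ∀ θ : ℝ, |klLocalPart L M β U μ K n θ| ≤ B)
    (hroom : ∀ n ≤ nScales β, ∀ j ≤ 4, G.S j + Q.S' j * |U| + (∑ i ∈ range (n + 1), msBar G Q U i) * R.Gfr j ≤ R.Gfr j)
    (h0 : ∑ m ∈ range (nScales β + 1), R.Gfr 0 * uPow 0 U * (4 : ℝ) ^ (((0 : ℤ) - 2) * m) ≤ 3 / 80)
    (h1 : ∑ m ∈ range (nScales β + 1), R.Gfr 1 * uPow 1 U * (4 : ℝ) ^ (((1 : ℤ) - 2) * m) ≤ 1 / 2000)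
    (h2 : ∑ m ∈ range (nScales β + 1), ∑ j ∈ range 3, R.Gfr j * uPow j U * (4 : ℝ) ^ (((j : ℤ) - 2) * m) ≤ 1 / 100)
    (d : ℕ) {η : ℝ} (hη : π ^ 6 / (d + 1) * ∑ i ∈ range (nScales β + 1), twoLegBar G Q U 1 i ≤ η)
    {K : TrigPolyC4v} (hK : FrameOK R U (nScales β) μ K) {n : ℕ} (hn : n ≤ nScales β)
    (hren : ∀ j < n, RenormalisedAtF L M β U μ K R j) {δ : ℝ} (hδ0 : 0 ≤ δ)
    (hδ : ∀ q : Fin 2 → ℝ, |K.eval q + ∑ i ∈ range (n + 1), klTwoLegPieceFn L M β U μ K.eval i q| ≤ δ)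
    (hfeas : ∀ j ≤ n, ∑ i ∈ Ico (j + 1) (n + 1), twoLegBar G Q U 0 i + 4 / 3 * (G.SL + Q.SL * |U|) * |U| * (δ + η) + η ≤
      ctCr G * |U| * klScale klE0 j ^ 2 / klE0) :
    FrameOK R U (nScales β) μ (ctIterJ L M d β U μ K n) ∧
    (∀ j ≤ n, RenormalisedAtF L M β U μ (ctIterJ L M d β U μ K n) R j) ∧
    (∀ j ≤ n, ∀ q : Fin 2 → ℝ,
      |(ctIterJ L M d β U μ K n).eval q +
          ∑ i ∈ range (j + 1), klTwoLegPieceFn L M β U μ (ctIterJ L M d β U μ K n).eval i q| ≤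
        ∑ i ∈ Ico (j + 1) (n + 1), twoLegBar G Q U 0 i + 4 / 3 * (G.SL + Q.SL * |U|) * |U| * (δ + η) + η) := by
  set K' := ctIterJ L M d β U μ K n with hK'def
  set qq : ℝ := 4 / 3 * (G.SL + Q.SL * |U|) * |U| with hqq
  have htlb1 : ∀ i, 0 ≤ twoLegBar G Q U 1 i := fun i => twoLegBar_nonneg' hG hQ U 1 i
  have hK' : FrameOK R U (nScales β) μ K' :=
    frameOK_jackson_of_multiSlotFn' (L := L) (M := M) hG hQ hR hn hμ
      (fun i hi => (blk K hK i (hi.trans hn) fun j hj => hren j (lt_of_lt_of_le hj hi)).2.2.1) (hroom n hn) h0 h1 h2 d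
  have hdisp : ∀ q, |K'.eval q - ctPhiJ L M β U μ K n q| ≤ η := by
    intro q
    refine (abs_eval_ctIterJ_sub_ctPhiJ_le blk hK hn hren d q).trans (le_trans ?_ hη)
    have hsub : range (n + 1) ⊆ range (nScales β + 1) := fun i hi =>
      mem_range.mpr (lt_of_lt_of_le (mem_range.mp hi) (Nat.succ_le_succ hn))
    exact mul_le_mul_of_nonneg_left (sum_le_sum_of_subset_of_nonneg hsub fun i _ _ => htlb1 i) (by positivity)
  have hη0 : 0 ≤ η := le_trans (abs_nonneg _) (hdisp 0)
  have hdist : frameDist K K' ≤ δ + η := by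
    refine ciSup_le fun p => ?_
    have e : K.eval p - K'.eval p = (K.eval p - ctPhiJ L M β U μ K n p) - (K'.eval p - ctPhiJ L M β U μ K n p) := by ring
    rw [e]
    refine (abs_sub _ _).trans (add_le_add ?_ (hdisp p))
    rw [← partialSumJ_eq]; exact hδ p
  have hSL : 0 ≤ G.SL := hG.2.2.2.2.2.2.2.2.2.2.2.2.2.2.2.2.2.2.2
  have hSL' : 0 ≤ Q.SL := hQ.2.2.2.2.2.2.1
  have hlip0 : ∀ i, 0 ≤ lipBar G Q U i := fun i => by rw [ct_lipBar_eq]; positivity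
  have main : ∀ j, j ≤ n →
      (∀ q : Fin 2 → ℝ, |K'.eval q + ∑ i ∈ range (j + 1), klTwoLegPieceFn L M β U μ K'.eval i q| ≤
        ∑ i ∈ Ico (j + 1) (n + 1), twoLegBar G Q U 0 i + qq * (δ + η) + η) ∧
      RenormalisedAtF L M β U μ K' R j := by
    intro j
    induction j using Nat.strong_induction_on with
    | _ j ih =>
      intro hj
      have hrenK' : ∀ j' < j, RenormalisedAtF L M β U μ K' R j' := fun j' hj' => (ih j' hj' (le_of_lt (lt_of_lt_of_le hj' hj))).2
      have hhist : ∀ j' < j, H K' j' := by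
        intro j' hj'
        have hb := blk K' hK' j' (le_of_lt (lt_of_lt_of_le (lt_of_lt_of_le hj' hj) hn)) fun i hi => hrenK' i (hi.trans hj')
        exact hb.2.2.2 (hrenK' j' hj')
      have hbound : ∀ q : Fin 2 → ℝ, |K'.eval q + ∑ i ∈ range (j + 1), klTwoLegPieceFn L M β U μ K'.eval i q| ≤
          ∑ i ∈ Ico (j + 1) (n + 1), twoLegBar G Q U 0 i + qq * (δ + η) + η := by
        intro q
        have hsplit := Finset.sum_range_add_sum_Ico (fun i => klTwoLegPieceFn L M β U μ K.eval i q) (Nat.succ_le_succ hj)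
        have hPhi : ctPhiJ L M β U μ K n q = -∑ i ∈ range (n + 1), klTwoLegPieceFn L M β U μ K.eval i q := rfl
        have hident : K'.eval q + ∑ i ∈ range (j + 1), klTwoLegPieceFn L M β U μ K'.eval i q =
            (K'.eval q - ctPhiJ L M β U μ K n q) +
            (∑ i ∈ range (j + 1), (klTwoLegPieceFn L M β U μ K'.eval i q - klTwoLegPieceFn L M β U μ K.eval i q) -
              ∑ i ∈ Ico (j + 1) (n + 1), klTwoLegPieceFn L M β U μ K.eval i q) := by
          rw [hPhi, ← hsplit, sum_sub_distrib]; ring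
        rw [hident]
        have hlipsum : |∑ i ∈ range (j + 1), (klTwoLegPieceFn L M β U μ K'.eval i q - klTwoLegPieceFn L M β U μ K.eval i q)| ≤
            qq * (δ + η) := by
          refine (abs_sum_le_sum_abs _ _).trans ?_
          have hterm : ∀ i ∈ range (j + 1),
              |klTwoLegPieceFn L M β U μ K'.eval i q - klTwoLegPieceFn L M β U μ K.eval i q| ≤ lipBar G Q U i * (δ + η) := by
            intro i hi
            have hij : i ≤ j := Nat.lt_succ_iff.mp (mem_range.mp hi)
            have hin : i ≤ nScales β := (hij.trans hj).trans hn
            have hlipi := (blk K hK i hin fun j' hj' => hren j' (lt_of_lt_of_le hj' (hij.trans hj))).2.1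
            have h := hlipi K' hK' (fun j' hj' => hhist j' (lt_of_lt_of_le hj' hij)) q
            rw [abs_sub_comm] at h
            exact h.trans (mul_le_mul_of_nonneg_left hdist (hlip0 i))
          refine (sum_le_sum hterm).trans ?_
          rw [← sum_mul]
          exact mul_le_mul_of_nonneg_right (ct_sum_lipBar_le hG hQ U (j + 1)) (by linarith)
        have htailsum : |∑ i ∈ Ico (j + 1) (n + 1), klTwoLegPieceFn L M β U μ K.eval i q| ≤
            ∑ i ∈ Ico (j + 1) (n + 1), twoLegBar G Q U 0 i := by
          refine (abs_sum_le_sum_abs _ _).trans (sum_le_sum fun i hi => ?_)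
          have hin : i ≤ n := Nat.lt_succ_iff.mp (mem_Ico.mp hi).2
          exact abs_pieceFn_le_of_blockJ blk hK (hin.trans hn) (fun j' hj' => hren j' (lt_of_lt_of_le hj' hin)) q
        calc |(K'.eval q - ctPhiJ L M β U μ K n q) +
              (∑ i ∈ range (j + 1), (klTwoLegPieceFn L M β U μ K'.eval i q - klTwoLegPieceFn L M β U μ K.eval i q) -
                ∑ i ∈ Ico (j + 1) (n + 1), klTwoLegPieceFn L M β U μ K.eval i q)|
            ≤ |K'.eval q - ctPhiJ L M β U μ K n q| +
              (|∑ i ∈ range (j + 1), (klTwoLegPieceFn L M β U μ K'.eval i q - klTwoLegPieceFn L M β U μ K.eval i q)| +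
                |∑ i ∈ Ico (j + 1) (n + 1), klTwoLegPieceFn L M β U μ K.eval i q|) :=
              (abs_add_le _ _).trans (add_le_add le_rfl (abs_sub _ _))
          _ ≤ η + (qq * (δ + η) + ∑ i ∈ Ico (j + 1) (n + 1), twoLegBar G Q U 0 i) :=
              add_le_add (hdisp q) (add_le_add hlipsum htailsum)
          _ = _ := by ring
      refine ⟨hbound, ?_⟩
      intro θ
      have h := hread K' hK' j (hj.trans hn) _ hbound θ
      have hf := hfeas j hj
      show |klLocalPart L M β U μ K' j θ| ≤ R.cr * |U| * klScale klE0 j ^ 2 / klE0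
      rw [hcr]
      linarith
  exact ⟨hK', fun j hj => (main j hj).2, fun j hj => (main j hj).1⟩

/-- **LEVEL-UP** (gen-5 block): a frame renormalised at every `j ≤ n` with `sup|S_n(K)| ≤ e` has `sup|S_{n+1}(K)| ≤ e + twoLegBar 0 (n+1)`. -/
theorem ct_levelUpJ
    (blk : ∀ K : TrigPolyC4v, FrameOK R U (nScales β) μ K → ∀ n : ℕ, n ≤ nScales β →
      (∀ j < n, RenormalisedAtF L M β U μ K R j) →
        TwoLegSizesFn L M G Q R β U μ K.eval n ∧ FrameLipschitzFnT L M H G Q R β U μ K n ∧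
          TwoLegSizesMSFn L M G Q R β U μ K.eval n ∧ (RenormalisedAtF L M β U μ K R n → H K n))
    {K : TrigPolyC4v} (hK : FrameOK R U (nScales β) μ K) {n : ℕ} (hn : n + 1 ≤ nScales β)
    (hren : ∀ j ≤ n, RenormalisedAtF L M β U μ K R j) {e : ℝ}
    (hS : ∀ q : Fin 2 → ℝ, |K.eval q + ∑ i ∈ range (n + 1), klTwoLegPieceFn L M β U μ K.eval i q| ≤ e) :
    (∀ j < n + 1, RenormalisedAtF L M β U μ K R j) ∧
    ∀ q : Fin 2 → ℝ, |K.eval q + ∑ i ∈ range (n + 1 + 1), klTwoLegPieceFn L M β U μ K.eval i q| ≤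
      e + twoLegBar G Q U 0 (n + 1) := by
  have hren' : ∀ j < n + 1, RenormalisedAtF L M β U μ K R j := fun j hj => hren j (Nat.lt_succ_iff.mp hj)
  refine ⟨hren', fun q => ?_⟩; rw [sum_range_succ, ← add_assoc]
  refine (abs_add_le _ _).trans (add_le_add (hS q) ?_)
  exact abs_pieceFn_le_of_blockJ blk hK hn hren' q

end Step

/-! ## §3 The induction over the levels and the one-volume continuation -/

section Main

variable {L M : ℕ} [NeZero L] [NeZero M] {G : GeoConsts} {Q : EngConsts} {β U μ : ℝ} {R : RenConsts}
  {H : TrigPolyC4v → ℕ → Prop}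

/-- **The induction over the levels** (one smoothed Picard step per level): for every `n ≤ N` there is an admissible frame, renormalised at
every `j ≤ n`, with `sup|S_j(K)| ≤ T̄_{j,n} + q·(2·twoLegBar 0 n + η) + η` for `j ≤ n`. -/
theorem ct_exists_postJ (hG : G.WF) (hQ : Q.WF) (hμ : μ ∈ klWindowC) (hR : ∀ j, 0 ≤ R.Gfr j) (hcr : R.cr = ctCr G)
    (blk : ∀ K : TrigPolyC4v, FrameOK R U (nScales β) μ K → ∀ n : ℕ, n ≤ nScales β →
      (∀ j < n, RenormalisedAtF L M β U μ K R j) →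
        TwoLegSizesFn L M G Q R β U μ K.eval n ∧ FrameLipschitzFnT L M H G Q R β U μ K n ∧
          TwoLegSizesMSFn L M G Q R β U μ K.eval n ∧ (RenormalisedAtF L M β U μ K R n → H K n))
    (hread : ∀ K : TrigPolyC4v, FrameOK R U (nScales β) μ K → ∀ n : ℕ, n ≤ nScales β → ∀ B : ℝ,
        (∀ q : Fin 2 → ℝ, |K.eval q + ∑ i ∈ range (n + 1), klTwoLegPieceFn L M β U μ K.eval i q| ≤ B) →
          ∀ θ : ℝ, |klLocalPart L M β U μ K n θ| ≤ B)
    (hS0' : Q.S' 0 * |U| ≤ 1 / 10) (hq : 4 / 3 * (G.SL + Q.SL * |U|) * |U| ≤ 1 / 1000)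
    (hroom : ∀ n ≤ nScales β, ∀ j ≤ 4, G.S j + Q.S' j * |U| + (∑ i ∈ range (n + 1), msBar G Q U i) * R.Gfr j ≤ R.Gfr j)
    (h0 : ∑ m ∈ range (nScales β + 1), R.Gfr 0 * uPow 0 U * (4 : ℝ) ^ (((0 : ℤ) - 2) * m) ≤ 3 / 80)
    (h1 : ∑ m ∈ range (nScales β + 1), R.Gfr 1 * uPow 1 U * (4 : ℝ) ^ (((1 : ℤ) - 2) * m) ≤ 1 / 2000)
    (h2 : ∑ m ∈ range (nScales β + 1), ∑ j ∈ range 3, R.Gfr j * uPow j U * (4 : ℝ) ^ (((j : ℤ) - 2) * m) ≤ 1 / 100)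
    (d : ℕ) {η : ℝ} (hη : π ^ 6 / (d + 1) * ∑ i ∈ range (nScales β + 1), twoLegBar G Q U 1 i ≤ η)
    (hηt : ∀ m ≤ nScales β, (1 + 4 / 3 * (G.SL + Q.SL * |U|) * |U|) * η ≤ twoLegBar G Q U 0 m / 2)
    (hηw : ∀ m ≤ nScales β, (1 + 4 / 3 * (G.SL + Q.SL * |U|) * |U|) * η ≤ |U| * ((16 : ℝ) ^ m)⁻¹ / 256)
    (n : ℕ) (hn : n ≤ nScales β) :
    ∃ K : TrigPolyC4v, FrameOK R U (nScales β) μ K ∧ (∀ j ≤ n, RenormalisedAtF L M β U μ K R j) ∧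
      ∀ j ≤ n, ∀ q : Fin 2 → ℝ, |K.eval q + ∑ i ∈ range (j + 1), klTwoLegPieceFn L M β U μ K.eval i q| ≤
        ∑ i ∈ Ico (j + 1) (n + 1), twoLegBar G Q U 0 i +
          4 / 3 * (G.SL + Q.SL * |U|) * |U| * (2 * twoLegBar G Q U 0 n + η) + η := by
  set qq : ℝ := 4 / 3 * (G.SL + Q.SL * |U|) * |U| with hqq
  have htlb0 : ∀ i, 0 ≤ twoLegBar G Q U 0 i := fun i => twoLegBar_nonneg' hG hQ U 0 i
  have htlb1 : ∀ i, 0 ≤ twoLegBar G Q U 1 i := fun i => twoLegBar_nonneg' hG hQ U 1 i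
  have hSL : 0 ≤ G.SL := hG.2.2.2.2.2.2.2.2.2.2.2.2.2.2.2.2.2.2.2
  have hSL' : 0 ≤ Q.SL := hQ.2.2.2.2.2.2.1
  have hqq0 : 0 ≤ qq := by positivity
  have hη0 : 0 ≤ η := le_trans (mul_nonneg (by positivity) (sum_nonneg fun i _ => htlb1 i)) hη
  -- feasibility of a step at level `m` with pre-step bound `2·twoLegBar 0 m` (budget with `wig := (1+q)η`)
  have hfeas : ∀ m ≤ nScales β, ∀ j ≤ m,
      ∑ i ∈ Ico (j + 1) (m + 1), twoLegBar G Q U 0 i + qq * (2 * twoLegBar G Q U 0 m + η) + η ≤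
        ctCr G * |U| * klScale klE0 j ^ 2 / klE0 := by
    intro m hm j hj
    have h := ct_budget (β := β) (fun _ => (1 + qq) * η) hG hQ (fun k hk => hηw k hk) hS0' hq hj hm
    beta_reduce at h
    rw [← hqq] at h
    have hS : 0 ≤ G.S 0 := hG.2.2.2.2.2.2.2.2.2.2.2.2.2.2.2.2.2.1 0
    have hcr0 : 0 ≤ ctCr G := by unfold ctCr; positivity
    have he0 : (0 : ℝ) < klE0 := by norm_num [klE0]
    have htolpos : 0 ≤ ctCr G * |U| * klScale klE0 j ^ 2 / klE0 := by positivity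
    have e : qq * (2 * twoLegBar G Q U 0 m + η) + η = qq * (2 * twoLegBar G Q U 0 m) + (1 + qq) * η := by ring
    linarith
  induction n with
  | zero =>
    have hzero : FrameOK R U (nScales β) μ (0 : TrigPolyC4v) := by
      refine frameOK_of_pieces hR hμ (K := 0) (Kp := fun _ => 0) (N := nScales β) (fun p => by simp [eval_fsub]) ?_ h0 h1 h2
      intro m _ j _ q
      rw [evalM_zero_eq, iteratedFDeriv_fun_zero]
      simp only [Pi.zero_apply, norm_zero]
      exact mul_nonneg (mul_nonneg (hR j) (uPow_nonneg j U)) (zpow_nonneg (by norm_num) _)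
    have hpre : ∀ q : Fin 2 → ℝ, |(0 : TrigPolyC4v).eval q + ∑ i ∈ range (0 + 1),
        klTwoLegPieceFn L M β U μ (0 : TrigPolyC4v).eval i q| ≤ 2 * twoLegBar G Q U 0 0 := by
      intro q
      rw [TrigPolyC4v.eval_zero, zero_add, zero_add, sum_range_one]
      have := abs_pieceFn_le_of_blockJ blk hzero (i := 0) (Nat.zero_le _) (fun j hj => absurd hj (Nat.not_lt_zero j)) q
      linarith [htlb0 0]
    obtain ⟨hK', hren', hS'⟩ := ct_stepJ hG hQ hμ hR hcr blk hread hroom h0 h1 h2 d hη hzero (Nat.zero_le _)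
      (fun j hj => absurd hj (Nat.not_lt_zero j)) (by linarith [htlb0 0]) hpre (hfeas 0 hn)
    exact ⟨_, hK', hren', hS'⟩
  | succ n ih =>
    obtain ⟨K, hK, hren, hS⟩ := ih (Nat.le_of_succ_le hn)
    have hSn : ∀ q : Fin 2 → ℝ, |K.eval q + ∑ i ∈ range (n + 1), klTwoLegPieceFn L M β U μ K.eval i q| ≤
        qq * (2 * twoLegBar G Q U 0 n + η) + η := by
      intro q
      have h := hS n le_rfl q
      rwa [Finset.Ico_self, sum_empty, zero_add] at h
    obtain ⟨hren', hpre⟩ := ct_levelUpJ blk hK hn hren hSn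
    have hpre' : ∀ q : Fin 2 → ℝ, |K.eval q + ∑ i ∈ range (n + 1 + 1), klTwoLegPieceFn L M β U μ K.eval i q| ≤
        2 * twoLegBar G Q U 0 (n + 1) := by
      intro q
      refine (hpre q).trans ?_
      have h16 : twoLegBar G Q U 0 n = 16 * twoLegBar G Q U 0 (n + 1) := by
        simp only [ct_twoLegBar_zero_eq, pow_succ, mul_inv]
        ring
      have hηn := hηt (n + 1) hn
      rw [h16]
      have e : qq * (2 * (16 * twoLegBar G Q U 0 (n + 1)) + η) + η =
          32 * qq * twoLegBar G Q U 0 (n + 1) + (1 + qq) * η := by ring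
      rw [e]
      nlinarith [htlb0 (n + 1)]
    obtain ⟨hK', hren'', hS'⟩ := ct_stepJ hG hQ hμ hR hcr blk hread hroom h0 h1 h2 d hη hK hn hren'
      (by linarith [htlb0 (n + 1)]) hpre' (hfeas (n + 1) hn)
    exact ⟨_, hK', hren'', hS'⟩

/-- **THE ONE-VOLUME CONTINUATION WITH THE SMOOTHED STEP, GIVEN THE EXACT READING**: at a volume carrying the gen-5 block and the
exact reading, under the numeric side conditions on `U`, the three allowance sums and the two smallness conditions on the smoothing displacement
`η`, there is an ADMISSIBLE `TrigPolyC4v` frame whose scale-`n` local part is within HALF the quadratic tolerance at every scale `n ≤ nScales β`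
and every real angle. -/
theorem ct_oneVolume_of_readingJ (hG : G.WF) (hQ : Q.WF) (hμ : μ ∈ klWindowC) (hR : ∀ j, 0 ≤ R.Gfr j) (hcr : R.cr = ctCr G)
    (blk : ∀ K : TrigPolyC4v, FrameOK R U (nScales β) μ K → ∀ n : ℕ, n ≤ nScales β →
      (∀ j < n, RenormalisedAtF L M β U μ K R j) →
        TwoLegSizesFn L M G Q R β U μ K.eval n ∧ FrameLipschitzFnT L M H G Q R β U μ K n ∧
          TwoLegSizesMSFn L M G Q R β U μ K.eval n ∧ (RenormalisedAtF L M β U μ K R n → H K n))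
    (hread : ∀ K : TrigPolyC4v, FrameOK R U (nScales β) μ K → ∀ n : ℕ, n ≤ nScales β → ∀ B : ℝ,
        (∀ q : Fin 2 → ℝ, |K.eval q + ∑ i ∈ range (n + 1), klTwoLegPieceFn L M β U μ K.eval i q| ≤ B) →
          ∀ θ : ℝ, |klLocalPart L M β U μ K n θ| ≤ B)
    (hS0' : Q.S' 0 * |U| ≤ 1 / 10) (hq : 4 / 3 * (G.SL + Q.SL * |U|) * |U| ≤ 1 / 1000)
    (hroom : ∀ n ≤ nScales β, ∀ j ≤ 4, G.S j + Q.S' j * |U| + (∑ i ∈ range (n + 1), msBar G Q U i) * R.Gfr j ≤ R.Gfr j)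
    (h0 : ∑ m ∈ range (nScales β + 1), R.Gfr 0 * uPow 0 U * (4 : ℝ) ^ (((0 : ℤ) - 2) * m) ≤ 3 / 80)
    (h1 : ∑ m ∈ range (nScales β + 1), R.Gfr 1 * uPow 1 U * (4 : ℝ) ^ (((1 : ℤ) - 2) * m) ≤ 1 / 2000)
    (h2 : ∑ m ∈ range (nScales β + 1), ∑ j ∈ range 3, R.Gfr j * uPow j U * (4 : ℝ) ^ (((j : ℤ) - 2) * m) ≤ 1 / 100)
    (d : ℕ) {η : ℝ} (hη : π ^ 6 / (d + 1) * ∑ i ∈ range (nScales β + 1), twoLegBar G Q U 1 i ≤ η)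
    (hηt : ∀ m ≤ nScales β, (1 + 4 / 3 * (G.SL + Q.SL * |U|) * |U|) * η ≤ twoLegBar G Q U 0 m / 2)
    (hηw : ∀ m ≤ nScales β, (1 + 4 / 3 * (G.SL + Q.SL * |U|) * |U|) * η ≤ |U| * ((16 : ℝ) ^ m)⁻¹ / 256) :
    ∃ K : TrigPolyC4v, FrameOK R U (nScales β) μ K ∧
      ∀ n ≤ nScales β, ∀ θ : ℝ, |klLocalPart L M β U μ K n θ| ≤ ctCr G * |U| * klScale klE0 n ^ 2 / klE0 / 2 := by
  set qq : ℝ := 4 / 3 * (G.SL + Q.SL * |U|) * |U| with hqq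
  obtain ⟨K, hK, -, hS⟩ :=
    ct_exists_postJ hG hQ hμ hR hcr blk hread hS0' hq hroom h0 h1 h2 d hη hηt hηw (nScales β) le_rfl
  refine ⟨K, hK, fun n hn θ => ?_⟩; have h := hread K hK n hn _ (hS n hn) θ
  have hb := ct_budget (β := β) (fun _ => (1 + qq) * η) hG hQ (fun k hk => hηw k hk) hS0' hq hn le_rfl
  beta_reduce at hb
  rw [← hqq] at hb h
  have e : qq * (2 * twoLegBar G Q U 0 (nScales β) + η) + η =
      qq * (2 * twoLegBar G Q U 0 (nScales β)) + (1 + qq) * η := by ring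
  linarith

end Main

end Summit.HubbardSuperconductivity.HubbardSuperconductivity.Theorems.KLRegimeSplit

end
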